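import Literature.RingTheory.FormalGroups.LazardRingGrading
import Literature.RingTheory.FormalGroups.AdditiveLawDeformation
import Literature.RingTheory.FormalGroups.SymmetricCocycleLemma
import Mathlib.Algebra.TrivSqZeroExt.Basic
import Mathlib.GroupTheory.QuotientGroup.Defs
import HarnessLib

/-!
# Linearisation of the Lazard ring in a fixed degree: the generic coefficients of degree `m` form a symmetric 2-cocycle
# ([Lazard1955] §II Lemme 3 ⇒ Thm. II; [Hazewinkel1978] §5.3–5.5)

Topic `Literature/RingTheory/FormalGroups`; namespace `Literature.RingTheory.FormalGroups`.  Plumbing definitions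
(`linVal`, `linHom`, `linPart`, `linImage`, `linCocycle`) and fully proved theorems; no named fact, no instance, no
notation, no `sorry`.

Fix a degree `m ≥ 2` (weight `m − 1`).  The ring map `linHom m : ℤ[a] → ℤ ⊕ ℤ^{(ℕ)}` into the square-zero extension
`TrivSqZeroExt ℤ (ℕ → ℤ)` sends the interior generic coefficient `a_{(i, m−i)}` to the basis vector `εᵢ` of the square-zero
part and every other variable to `0`; it pushes the generic series `F_gen` (file `LazardRing`) to the perturbed additive law
`X + Y + Σ_{0<i<m} εᵢ XⁱY^{m−i}` (file `AdditiveLawDeformation`), so (`linHom_coeff_assocDiff`) the image of the Lazard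
relations `N_m = linHom(I) ⊆ ℤ^{(ℕ)}` contains `C(i+j,i) ε_{i+j} − C(j+k,j) εᵢ` and `ε_{m−i} − εᵢ`: the classes of the `εᵢ` in
`ℤ^{(ℕ)} ⧸ N_m` form a SYMMETRIC 2-COCYCLE of degree `m` (`isSymmCocycle_linCocycle`).  By Lazard's symmetric 2-cocycle
lemma over an arbitrary abelian group (★ `SymmetricCocycleLemma`, `IsSymmCocycle.exists_eq_cocycleCoeff_smul`) and the
Bezout vector `w` of the primitive coefficients `c_{m,i} = C(m,i)/ν(m)` (★ `CocyclePolynomial`), every `εᵢ` is congruent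
mod `N_m` to `c_{m,i} · Σ_b w_b ε_b`: there is a Lazard relation whose LINEAR PART in degree `m` (`linPart m`, the vector of
coefficients of the monomials `a_{(b, m−b)}`) is `εᵢ − c_{m,i} Σ_b w_b ε_b` (`exists_mem_lazardIdeal_linPart_eq`).  The
sibling `LazardRingGenerators` turns this into generators of the Lazard ring.

## References
* [Lazard1955] M. Lazard, *Sur les groupes de Lie formels à un paramètre*, Bull. SMF 83 (1955), §II Lemme 3, Thm. II.
* [Hazewinkel1978] M. Hazewinkel, *Formal Groups and Applications* (1978), §5.3–§5.5.
-/

noncomputable section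

namespace Literature.RingTheory.FormalGroups

open _root_.MvPowerSeries (HasSubst subst coeff)
open Finset

/-! ## §1 The linearisation ring map and the linear part -/

/-- Value of the linearisation on the variable `a_d` in degree `m`: the basis vector `ε_{d₀}` of the square-zero part
when `d` is interior of degree `m`, else `0`. [cite: Hazewinkel1978, §5.3] -/
def linVal (m : ℕ) (d : Fin 2 →₀ ℕ) : TrivSqZeroExt ℤ (ℕ → ℤ) :=
  if 0 < d 0 ∧ 0 < d 1 ∧ d 0 + d 1 = m then TrivSqZeroExt.inr (Pi.single (d 0) 1) else 0

/-- **The linearisation in degree `m`**: the ring map `ℤ[a] → ℤ ⊕ ℤ^ℕ` (square-zero extension), `a_d ↦ linVal m d`.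
[cite: Hazewinkel1978, §5.3] -/
def linHom (m : ℕ) : LazardGen →+* TrivSqZeroExt ℤ (ℕ → ℤ) :=
  MvPolynomial.eval₂Hom (Int.castRingHom _) (linVal m)

/-- `linHom m (a_d) = linVal m d`. [cite: Hazewinkel1978, §5.3] -/
@[simp] theorem linHom_X (m : ℕ) (d : Fin 2 →₀ ℕ) : linHom m (MvPolynomial.X d) = linVal m d := by
  simp [linHom]

/-- The square-zero coordinates `εₐ = (0, δₐ)` for `0 < a < m` (and `0` otherwise). [cite: Hazewinkel1978, §5.3] -/
def linEps (m : ℕ) (a : ℕ) : TrivSqZeroExt ℤ (ℕ → ℤ) :=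
  if 0 < a ∧ a < m then TrivSqZeroExt.inr (Pi.single a 1) else 0

/-- The `ε`'s have vanishing pairwise products (square zero). [cite: Hazewinkel1978, §5.3] -/
theorem linEps_mul_linEps (m a b : ℕ) : linEps m a * linEps m b = 0 := by
  unfold linEps
  split_ifs <;> simp [TrivSqZeroExt.inr_mul_inr]

/-- First components: `fst (εₐ) = 0`. [cite: Hazewinkel1978, §5.3] -/
@[simp] theorem fst_linEps (m a : ℕ) : (linEps m a).fst = 0 := by
  unfold linEps; split_ifs <;> simp

/-- First components: `fst (linVal m d) = 0`. [cite: Hazewinkel1978, §5.3] -/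
@[simp] theorem fst_linVal (m : ℕ) (d : Fin 2 →₀ ℕ) : (linVal m d).fst = 0 := by
  unfold linVal; split_ifs <;> simp

/-- **The linearisation of the generic series is the perturbed additive law** `X + Y + Σ_{0<a<m} εₐ XᵃY^{m−a}` (`m ≥ 2`).
[cite: Hazewinkel1978, §5.3] -/
theorem map_linHom_genericLaw {m : ℕ} (hm : 2 ≤ m) :
    MvPowerSeries.map (linHom m) genericLaw = pertAdd (linEps m) m := by
  refine MvPowerSeries.ext fun d => ?_
  rw [MvPowerSeries.coeff_map, coeff_genericLaw, coeff_pertAdd _ _ hm]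
  by_cases hd : 0 < d 0 ∧ 0 < d 1
  · rw [if_pos hd, if_pos hd, linHom_X, linVal, linEps]
    by_cases hs : d 0 + d 1 = m
    · rw [if_pos ⟨hd.1, hd.2, hs⟩, if_pos hs, if_pos ⟨hd.1, by omega⟩]
    · rw [if_neg (fun h => hs h.2.2), if_neg hs]
  · rw [if_neg hd, if_neg hd]
    split_ifs <;> simp

/-- **The linear part in degree `m`** of a polynomial `r ∈ ℤ[a]`: the vector `b ↦` coefficient of the degree-one monomial
`a_{(b, m−b)}` in `r` (`0 < b < m`; `0` elsewhere). [cite: Hazewinkel1978, §5.3] -/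
def linPart (m : ℕ) (r : LazardGen) : ℕ → ℤ := fun b =>
  if 0 < b ∧ b < m then MvPolynomial.coeff (Finsupp.single (Finsupp.single 0 b + Finsupp.single 1 (m - b)) 1) r else 0

/-- The linear part of `0` vanishes. [cite: Hazewinkel1978, §5.3] -/
@[simp] theorem linPart_zero (m : ℕ) : linPart m 0 = 0 := by
  funext b; simp [linPart]

/-- The linear part is additive. [cite: Hazewinkel1978, §5.3] -/
theorem linPart_add (m : ℕ) (r s : LazardGen) : linPart m (r + s) = linPart m r + linPart m s := by
  funext b; simp only [linPart, Pi.add_apply, MvPolynomial.coeff_add]; split_ifs <;> simp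

/-- **The linearisation reads off the constant term and the linear part**: `linHom m r = (r(0), linPart m r)`.
[cite: Hazewinkel1978, §5.3] -/
theorem linHom_eq (m : ℕ) (r : LazardGen) :
    (linHom m r).fst = MvPolynomial.constantCoeff r ∧ (linHom m r).snd = linPart m r := by
  classical
  induction r using MvPolynomial.induction_on with
  | C z =>
    refine ⟨by simp [linHom], ?_⟩
    funext b
    simp only [linHom, MvPolynomial.eval₂Hom_C, Int.coe_castRingHom, TrivSqZeroExt.snd_intCast, linPart,
      MvPolynomial.coeff_C]
    rw [if_neg (Finsupp.single_ne_zero.mpr one_ne_zero).symm]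
    split_ifs <;> rfl
  | add p q hp hq =>
    refine ⟨by rw [map_add, TrivSqZeroExt.fst_add, hp.1, hq.1, map_add], ?_⟩
    rw [map_add, TrivSqZeroExt.snd_add, hp.2, hq.2, linPart_add]
  | mul_X p d hp =>
    refine ⟨by rw [map_mul, TrivSqZeroExt.fst_mul, linHom_X, fst_linVal, mul_zero, map_mul,
      MvPolynomial.constantCoeff_X, mul_zero], ?_⟩
    rw [map_mul, TrivSqZeroExt.snd_mul, linHom_X, fst_linVal, hp.1, MulOpposite.op_zero, zero_smul, add_zero]
    funext b
    rw [Pi.smul_apply, smul_eq_mul]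
    -- both sides are `p(0)` exactly when `0 < b < m` and `d = (b, m - b)`, and `0` otherwise
    have key : ((0 < d 0 ∧ 0 < d 1 ∧ d 0 + d 1 = m) ∧ b = d 0) ↔
        (0 < b ∧ b < m ∧ d = Finsupp.single 0 b + Finsupp.single 1 (m - b)) := by
      constructor
      · rintro ⟨⟨h0, h1, hs⟩, rfl⟩
        exact ⟨h0, by omega, by ext s; fin_cases s <;> simp; omega⟩
      · rintro ⟨hb, hbm, rfl⟩
        refine ⟨⟨by simpa using hb, by simp; omega, by simp; omega⟩, by simp⟩
    have hL : (linVal m d).snd b = if (0 < d 0 ∧ 0 < d 1 ∧ d 0 + d 1 = m) ∧ b = d 0 then 1 else 0 := by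
      unfold linVal
      by_cases hq : 0 < d 0 ∧ 0 < d 1 ∧ d 0 + d 1 = m
      · rw [if_pos hq, TrivSqZeroExt.snd_inr, Pi.single_apply]
        by_cases hbd : b = d 0
        · rw [if_pos hbd, if_pos ⟨hq, hbd⟩]
        · rw [if_neg hbd, if_neg (fun h => hbd h.2)]
      · rw [if_neg hq, TrivSqZeroExt.snd_zero, Pi.zero_apply, if_neg (fun h => hq h.1)]
    have hR : linPart m (p * MvPolynomial.X d) b =
        if 0 < b ∧ b < m ∧ d = Finsupp.single 0 b + Finsupp.single 1 (m - b) then MvPolynomial.coeff 0 p else 0 := by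
      unfold linPart
      by_cases hb : 0 < b ∧ b < m
      · rw [if_pos hb, MvPolynomial.coeff_mul_X']
        by_cases hd : d = Finsupp.single 0 b + Finsupp.single 1 (m - b)
        · rw [if_pos (by rw [hd]; simp), if_pos ⟨hb.1, hb.2, hd⟩, hd, tsub_self]
        · have hmem : d ∉ (Finsupp.single (Finsupp.single (0 : Fin 2) b + Finsupp.single 1 (m - b)) (1 : ℕ)).support :=
            by rw [Finsupp.support_single _ one_ne_zero, Finset.mem_singleton]; exact hd
          rw [if_neg hmem, if_neg (fun h => hd h.2.2)]
      · rw [if_neg hb, if_neg (fun h => hb ⟨h.1, h.2.1⟩)]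
    rw [hL, hR]
    by_cases h : 0 < b ∧ b < m ∧ d = Finsupp.single 0 b + Finsupp.single 1 (m - b)
    · rw [if_pos h, if_pos (key.mpr h), mul_one]; rfl
    · rw [if_neg h, if_neg (fun h' => h (key.mp h')), mul_zero]

/-- `snd (linHom m r) = linPart m r`. [cite: Hazewinkel1978, §5.3] -/
theorem snd_linHom (m : ℕ) (r : LazardGen) : (linHom m r).snd = linPart m r := (linHom_eq m r).2

/-! ## §2 The image of the Lazard ideal and the cocycle of the `εᵢ` -/

/-- **The image `N_m ⊆ ℤ^ℕ` of the Lazard ideal under the linearisation** (an additive subgroup of the square-zero part).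
[cite: Hazewinkel1978, §5.3] -/
def linImage (m : ℕ) : AddSubgroup (ℕ → ℤ) :=
  (lazardIdeal.toAddSubgroup).map
    ((TrivSqZeroExt.sndHom ℤ (ℕ → ℤ)).toAddMonoidHom.comp (linHom m).toAddMonoidHom)

/-- Membership in `N_m`: the second component of the linearisation of a relation. [cite: Hazewinkel1978, §5.3] -/
theorem snd_linHom_mem_linImage (m : ℕ) {r : LazardGen} (hr : r ∈ lazardIdeal) : (linHom m r).snd ∈ linImage m :=
  ⟨r, hr, rfl⟩

/-- Elements of `N_m` are linear parts of relations. [cite: Hazewinkel1978, §5.3] -/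
theorem exists_linPart_eq_of_mem_linImage (m : ℕ) {v : ℕ → ℤ} (hv : v ∈ linImage m) :
    ∃ r ∈ lazardIdeal, linPart m r = v := by
  obtain ⟨r, hr, rfl⟩ := hv
  exact ⟨r, hr, (snd_linHom m r).symm⟩

/-- **The cocycle of the `εᵢ`**: the class of `εᵢ` in `ℤ^ℕ ⧸ N_m` for `0 < i < m`, zero otherwise. [cite: Lazard1955, §II Lemme 3] -/
def linCocycle (m : ℕ) (i : ℕ) : (ℕ → ℤ) ⧸ linImage m :=
  if 0 < i ∧ i < m then ((Pi.single i 1 : ℕ → ℤ) : (ℕ → ℤ) ⧸ linImage m) else 0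

/-- The linearisation of the variable `a_{(i, m−i)}` is `εᵢ` (`0 < i < m`). [cite: Hazewinkel1978, §5.3] -/
theorem snd_linHom_X_e2 {m i : ℕ} (hi : 0 < i) (him : i < m) :
    (linHom m (MvPolynomial.X (Finsupp.single 0 i + Finsupp.single 1 (m - i)))).snd = Pi.single i 1 := by
  rw [linHom_X, linVal, if_pos (by simp; omega)]
  simp

/-- **Symmetry relation in `N_m`**: `ε_{m−i} − εᵢ ∈ N_m` (from the relation `a_d − a_{d̄}`). [cite: Lazard1955, §II Lemme 3] -/
theorem single_sub_single_mem_linImage {m i : ℕ} (hi : 0 < i) (him : i < m) :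
    (Pi.single (m - i) 1 - Pi.single i 1 : ℕ → ℤ) ∈ linImage m := by
  have hsw : swapIdx (Finsupp.single 0 i + Finsupp.single 1 (m - i)) =
      Finsupp.single 0 (m - i) + Finsupp.single 1 (m - (m - i)) := by
    ext s; fin_cases s <;> simp; omega
  have hmem := lazardIdeal.neg_mem (X_sub_X_swapIdx_mem_lazardIdeal (Finsupp.single 0 i + Finsupp.single 1 (m - i)))
  have h := snd_linHom_mem_linImage m hmem
  rwa [map_neg, map_sub, TrivSqZeroExt.snd_neg, TrivSqZeroExt.snd_sub, hsw, snd_linHom_X_e2 hi him,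
    snd_linHom_X_e2 (by omega) (by omega), neg_sub] at h

/-- **Associativity relation in `N_m`**: `C(i+j,i) ε_{i+j} − C(j+k,j) εᵢ ∈ N_m` for `i,j,k ≥ 1`, `i+j+k = m` (from the
associator relation at `XⁱYʲZᵏ`). [cite: Lazard1955, §II Lemme 3] -/
theorem choose_single_sub_mem_linImage {m i j k : ℕ} (hi : 0 < i) (hj : 0 < j) (hk : 0 < k) (hm : i + j + k = m) :
    (((i + j).choose i : ℤ) • (Pi.single (i + j) 1 : ℕ → ℤ) - ((j + k).choose j : ℤ) • Pi.single i 1) ∈ linImage m := by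
  have h2 : 2 ≤ m := by omega
  have hmem := coeff_assocDiff_genericLaw_mem_lazardIdeal (Finsupp.single 0 i + Finsupp.single 1 j + Finsupp.single 2 k)
  have h := snd_linHom_mem_linImage m hmem
  rw [← MvPowerSeries.coeff_map, ← assocDiff_map _ _ constantCoeff_genericLaw, map_linHom_genericLaw h2,
    coeff_assocDiff_pertAdd _ _ (linEps_mul_linEps m) i j k hi hj hk hm, TrivSqZeroExt.snd_sub] at h
  have e1 : ((((i + j).choose i : ℕ) : TrivSqZeroExt ℤ (ℕ → ℤ)) * linEps m (i + j)).snd =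
      ((i + j).choose i : ℤ) • (Pi.single (i + j) 1 : ℕ → ℤ) := by
    rw [TrivSqZeroExt.snd_mul, TrivSqZeroExt.fst_natCast, TrivSqZeroExt.snd_natCast, smul_zero, add_zero, linEps,
      if_pos ⟨by omega, by omega⟩, TrivSqZeroExt.snd_inr, Nat.cast_smul_eq_nsmul, ← Nat.cast_smul_eq_nsmul ℤ]
  have e2' : ((((j + k).choose j : ℕ) : TrivSqZeroExt ℤ (ℕ → ℤ)) * linEps m i).snd =
      ((j + k).choose j : ℤ) • (Pi.single i 1 : ℕ → ℤ) := by
    rw [TrivSqZeroExt.snd_mul, TrivSqZeroExt.fst_natCast, TrivSqZeroExt.snd_natCast, smul_zero, add_zero, linEps,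
      if_pos ⟨hi, by omega⟩, TrivSqZeroExt.snd_inr, Nat.cast_smul_eq_nsmul, ← Nat.cast_smul_eq_nsmul ℤ]
  rwa [e1, e2'] at h

/-- **The `εᵢ` form a symmetric 2-cocycle of degree `m` in `ℤ^ℕ ⧸ N_m`** (`m ≥ 2`). [cite: Lazard1955, §II Lemme 3] -/
theorem isSymmCocycle_linCocycle {m : ℕ} (hm : 2 ≤ m) : IsSymmCocycle m (linCocycle m) where
  eq_zero_of_lt i hi := by rw [linCocycle, if_neg (by omega)]
  symm i hi := by
    unfold linCocycle
    by_cases h : 0 < i ∧ i < m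
    · rw [if_pos h, if_pos (by omega), QuotientAddGroup.eq_iff_sub_mem]
      exact single_sub_single_mem_linImage h.1 h.2
    · rw [if_neg h, if_neg (by omega)]
  cocycle i j k hijk := by
    have _ := hm
    unfold linCocycle
    rcases Nat.eq_zero_or_pos i with rfl | hi
    · simp
    rcases Nat.eq_zero_or_pos k with rfl | hk
    · have him : ¬(0 < i + j ∧ i + j < m) := by omega
      rw [if_neg hi.ne', if_neg him, zero_add, smul_zero, zero_add, if_pos rfl, add_zero, Nat.choose_self, one_smul]
    rw [if_neg hi.ne', if_neg hk.ne', zero_add, add_zero]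
    rcases Nat.eq_zero_or_pos j with rfl | hj
    · simp
    rw [if_pos (show 0 < i ∧ i < m by omega), if_pos (show 0 < i + j ∧ i + j < m by omega), eq_comm, ← sub_eq_zero,
      ← Nat.cast_smul_eq_nsmul ℤ, ← Nat.cast_smul_eq_nsmul ℤ ((j + k).choose j), ← QuotientAddGroup.mk_zsmul,
      ← QuotientAddGroup.mk_zsmul, ← QuotientAddGroup.mk_sub, QuotientAddGroup.eq_zero_iff]
    exact choose_single_sub_mem_linImage hi hj hk hijk

/-- **Lazard's lemma applied**: with the Bezout vector `w` (`Σ_{b<m} w_b c_{m,b} = 1`), every `εᵢ` (`0 < i < m`) is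
congruent mod `N_m` to `c_{m,i} · Σ_{b<m} w_b ε_b`; precisely, the vector `δᵢ − Σ_{0<b<m} c_{m,i} w_b δ_b` lies in `N_m`.
[cite: Lazard1955, §II Lemme 3] -/
theorem single_sub_sum_mem_linImage {m : ℕ} (hm : 2 ≤ m) {w : ℕ → ℤ}
    (hw : ∑ b ∈ range m, w b * (cocycleCoeff m b : ℤ) = 1) {i : ℕ} (hi : 0 < i) (him : i < m) :
    ((Pi.single i 1 : ℕ → ℤ) - ∑ b ∈ Ioo 0 m, ((cocycleCoeff m i : ℤ) * w b) • Pi.single b 1) ∈ linImage m := by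
  obtain ⟨t, ht⟩ := (isSymmCocycle_linCocycle hm).exists_eq_cocycleCoeff_smul hm
  -- `t = Σ_b w_b • ε_b`
  have htw : t = ∑ b ∈ range m, w b • linCocycle m b := by
    have hb : ∀ b, w b • linCocycle m b = (w b * (cocycleCoeff m b : ℤ)) • t := fun b => by
      rw [ht b, ← Nat.cast_smul_eq_nsmul ℤ, smul_smul]
    simp_rw [hb, ← Finset.sum_smul, hw, one_smul]
  have hsum : ∑ b ∈ range m, w b • linCocycle m b =
      (((∑ b ∈ Ioo 0 m, w b • Pi.single b 1 : ℕ → ℤ)) : (ℕ → ℤ) ⧸ linImage m) := by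
    rw [QuotientAddGroup.mk_sum]
    have hsub : Ioo 0 m ⊆ range m := fun b hb => by rw [mem_Ioo] at hb; exact mem_range.mpr hb.2
    rw [← sum_subset hsub]
    · refine sum_congr rfl fun b hb => ?_
      rw [mem_Ioo] at hb
      rw [linCocycle, if_pos hb, QuotientAddGroup.mk_zsmul]
    · intro b hb hb'
      rw [mem_range] at hb; rw [mem_Ioo] at hb'
      rw [linCocycle, if_neg (by omega), smul_zero]
  have hi' := ht i
  rw [linCocycle, if_pos ⟨hi, him⟩, htw, hsum, ← Nat.cast_smul_eq_nsmul ℤ, ← QuotientAddGroup.mk_zsmul,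
    QuotientAddGroup.eq_iff_sub_mem, smul_sum] at hi'
  simp_rw [← mul_smul] at hi'
  exact hi'

/-- **Main output of the linearisation**: for `m ≥ 2`, the Bezout vector `w` and `0 < i < m`, there is a Lazard relation
`r ∈ I` whose linear part in degree `m` is `δᵢ − c_{m,i} Σ_{0<b<m} w_b δ_b`. [cite: Lazard1955, §II Lemme 3] -/
theorem exists_mem_lazardIdeal_linPart_eq {m : ℕ} (hm : 2 ≤ m) {w : ℕ → ℤ}
    (hw : ∑ b ∈ range m, w b * (cocycleCoeff m b : ℤ) = 1) {i : ℕ} (hi : 0 < i) (him : i < m) :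
    ∃ r ∈ lazardIdeal, linPart m r =
      (Pi.single i 1 : ℕ → ℤ) - ∑ b ∈ Ioo 0 m, ((cocycleCoeff m i : ℤ) * w b) • Pi.single b 1 :=
  exists_linPart_eq_of_mem_linImage m (single_sub_sum_mem_linImage hm hw hi him)

end Literature.RingTheory.FormalGroups
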